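import Literature.Topology.FourManifolds.LatticeFormsSpecialOrthogonalHyperbolicSum
import HarnessLib

/-!
# `SO⁺(U^{⊕n})` is perfect, `[SO⁺, SO⁺] = [O⁺, O⁺] = [O, O] = SO⁺(U^{⊕n})`, `O⁺(U^{⊕n})^{ab} ≅ ℤ/2ℤ`,
# `O(U^{⊕n})^{ab} ≅ (ℤ/2ℤ)²`, and the characters of `SO⁺`, `O⁺`, `O` — for ALL `n ≥ 3`
# (Gritsenko–Hulek–Sankaran, *J. Algebra* 322 (2009), Thm. 1.7, Cor. 1.8, Prop. 1.6, §4.1 — the family `L = U^{⊕n}`)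

Trunk T-4MAN vocabulary. Row g49-#9 spelled this out for `3U` in the nested model; row g49-#15 proved the pair-free
`[O(U^{⊕n}), O(U^{⊕n})] = SO⁺(U^{⊕n})` (words in commutators of arbitrary isometries); row g50-#1 proved GHS (15)
`SO⁺(U^{⊕n}) = E_{U_i}(U_i^⊥)` (admissible Eichler words at any plane). Since `E_U(L₁)` is perfect as soon as `L` is even
with three hyperbolic planes (row g49-#6, §4.1 of the paper), Theorem 1.7's "`S̃O⁺(L)^{ab}` is trivial" follows for every
`L = U^{⊕n}`, `n ≥ 3`, in the strong sense: every element of `SO⁺` is a word in commutators of elements of `SO⁺` (indeed of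
`E_{U_i}`). This file records that, the resulting identification of the three commutator subgroups, the coset structure
`O/SO⁺ ≅ {±1}²` via `(sn_ℝ, det)`, and Corollary 1.8 as statements about homomorphisms to abelian groups. Written for lane
`lit-hodgefound` (Track 2 foundations; prover seat `lit-hodgefound-p18`, gen 50, row g50-#2). THEOREMS ONLY — no
definition, no named fact, no instance, no notation.

## Source, verbatim (held text `paper:arxiv-0810.1614`, p. 4 and p. 8)

"**Proposition 1.6** Let `L = 2U ⊕ L₁` be an even unimodular lattice of rank at least `6`. Then `S̃O⁺(L)^{ab}` is trivial
and `Õ⁺(L)^{ab} ≅ ℤ/2ℤ`." "**Theorem 1.7** Let `L` be an even integral lattice containing at least two hyperbolic planes,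
such that `rank₂(L) ≥ 6` and `rank₃(L) ≥ 5`. Then `S̃O⁺(L)^{ab}` is trivial and `Õ⁺(L)^{ab} ≅ ℤ/2ℤ`." "**Corollary 1.8**
For `L` a lattice as in Theorem 1.7, the orthogonal group `Õ⁺(L)` has only one non-trivial character, namely `det`, and
`S̃O⁺(L)` has no non-trivial characters." p. 4, for `L_{2d}`: "`[O(L_{2d}), O(L_{2d})] = S̃O⁺(L_{2d})` and
`O(L_{2d})^{ab} ≅ (ℤ/2ℤ)^{ρ(d)+2}`." §4 p. 8: "It is enough to prove Theorem 1.7 for `S̃O⁺(L)` (or, equivalently by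
equation (16), for `E(L)`), because `Õ⁺(L) = ⟨S̃O⁺(L), σ_{e−f}⟩`."

For `L = U^{⊕n}` (even, unimodular: `Õ = O`, `S̃O⁺ = SO⁺`, `O(q_L) = 1`; `rank_p = 2n ≥ 6`) these read: `SO⁺(U^{⊕n})`
perfect, `O⁺(U^{⊕n})^{ab} ≅ ℤ/2ℤ`, `O(U^{⊕n})^{ab} ≅ (ℤ/2ℤ)²`; proved here for `n ≥ 3` from rows g49-#6 and g50-#1 (no Kneser).

## Contents (all proved); `[α,β] = αβα⁻¹β⁻¹ = ((β⁻¹·α⁻¹)·β)·α` in `IsometryEquiv.trans` order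

* §1 **Thm. 1.7 (i), `SO⁺(U^{⊕n})` is perfect**: every `φ ∈ SO⁺(hyperbolicSum n)` is a word in any set containing the
  commutators of admissible words at the plane `U_i` (`hyperbolicSum_isWordIn_commutators_uGens_of_isOrientationPreserving_of_det_eq_one`);
  `[SO⁺, SO⁺] = SO⁺` (`hyperbolicSum_isWordIn_commutators_of_specialOrthogonal_iff`), `[O⁺, O⁺] = SO⁺`
  (`hyperbolicSum_isWordIn_commutators_of_isOrientationPreserving_iff`); `[O, O] = SO⁺` is row g49-#15.
* §2 **the cosets of `SO⁺` in `O`**: `φρ⁻¹ ∈ [O, O] ⟺ (χ(φ) = χ(ρ) ∧ det φ = det ρ)`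
  (`hyperbolicSum_isWordIn_commutators_trans_symm_iff`); representatives `1`, `σ₋ = σ_{e_j−f_j}` (`χ = 1`, `det = −1`),
  `σ₊ = σ_{e_j+f_j}` (`χ = −1`, `det = −1`), `σ₋σ₊` (`χ = −1`, `det = 1`); **Thm. 1.7 (ii) `O⁺(U^{⊕n})^{ab} ≅ ℤ/2ℤ`**
  (`hyperbolicSum_xor_isWordIn_commutators_of_isOrientationPreserving`) and **`O(U^{⊕n})^{ab} ≅ (ℤ/2ℤ)²`**
  (`hyperbolicSum_isWordIn_commutators_or_or_or`).
* §3 **Cor. 1.8 (characters)**, for maps `f` to an abelian group multiplicative on the subgroup in question: every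
  character of `SO⁺(U^{⊕n})` is trivial (`hyperbolicSum_character_eq_one_of_specialOrthogonal`); every character of
  `O⁺(U^{⊕n})` factors through `det` (`hyperbolicSum_character_eq_of_isOrientationPreserving_of_det_eq`); every character of
  `O(U^{⊕n})` factors through `(χ, det)` and is `2`-torsion (`hyperbolicSum_character_eq_of_det_eq`,
  `hyperbolicSum_character_mul_self`). The generic plumbing (`IsWordIn.map_eq_one_of_commutators_of_map_trans`: a map
  multiplicative on a subgroup `G` kills words in commutators of elements of `G`) is stated for any lattice.
-/

noncomputable section

open Module
open LinearMap (BilinForm)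
open LinearMap.BilinForm
open LinearMap.BilinForm (IsometryEquiv)

namespace Literature.Topology.FourManifolds

universe u

/-! ### §0 Plumbing: `SO⁺(L)` is closed under `1`, products, inverses; characters kill commutators -/

section Closure

variable {L : Type u} [AddCommGroup L] [Module.Finite ℤ L] [Module.Free ℤ L] {Q : BilinForm ℤ L}

/-- `1 ∈ SO⁺(L)`. [cite: GritsenkoHulekSankaran2009, §1 ("SO⁺(L) = O⁺(L) ∩ SO(L)")] -/
theorem specialOrthogonal_refl :
    (LinearMap.BilinForm.IsometryEquiv.refl Q).IsOrientationPreserving ∧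
      LinearMap.det ((LinearMap.BilinForm.IsometryEquiv.refl Q : Q.IsometryEquiv Q) : L →ₗ[ℤ] L) = 1 :=
  (refl_mem_stableSpecialOrthogonal (B := Q)).2

/-- `SO⁺(L)` is closed under products (`Q` symmetric non-degenerate). [cite: GritsenkoHulekSankaran2009, §1 ("SO⁺(L) = O⁺(L) ∩ SO(L)")] -/
theorem specialOrthogonal_trans (hQ : Q.IsSymm) (hnd : Q.Nondegenerate) (α β : Q.IsometryEquiv Q)
    (hα : α.IsOrientationPreserving ∧ LinearMap.det (α : L →ₗ[ℤ] L) = 1)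
    (hβ : β.IsOrientationPreserving ∧ LinearMap.det (β : L →ₗ[ℤ] L) = 1) :
    (α.trans β).IsOrientationPreserving ∧ LinearMap.det ((α.trans β : Q.IsometryEquiv Q) : L →ₗ[ℤ] L) = 1 :=
  ⟨(LinearMap.BilinForm.IsometryEquiv.isOrientationPreserving_trans_iff hQ hnd α β).2 (iff_of_true hβ.1 hα.1),
    by rw [IsometryEquiv.det_trans_eq_mul, hα.2, hβ.2, mul_one]⟩

/-- `SO⁺(L)` is closed under inverses (`Q` symmetric non-degenerate). [cite: GritsenkoHulekSankaran2009, §1 ("SO⁺(L) = O⁺(L) ∩ SO(L)")] -/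
theorem specialOrthogonal_symm (hQ : Q.IsSymm) (hnd : Q.Nondegenerate) (α : Q.IsometryEquiv Q)
    (hα : α.IsOrientationPreserving ∧ LinearMap.det (α : L →ₗ[ℤ] L) = 1) :
    α.symm.IsOrientationPreserving ∧ LinearMap.det ((α.symm : Q.IsometryEquiv Q) : L →ₗ[ℤ] L) = 1 := by
  refine ⟨(LinearMap.BilinForm.IsometryEquiv.isOrientationPreserving_symm_iff hQ hnd α).2 hα.1, ?_⟩
  have h := IsometryEquiv.det_symm_mul_det_eq_one α
  rwa [hα.2, mul_one] at h

omit [Module.Finite ℤ L] [Module.Free ℤ L] in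
/-- `det α⁻¹ = det α` for an isometry of a lattice (`det = ±1`). [cite: GritsenkoHulekSankaran2009, Cor. 1.8 ("det" is a character)] -/
theorem IsometryEquiv.det_symm_eq (α : Q.IsometryEquiv Q) :
    LinearMap.det ((α.symm : Q.IsometryEquiv Q) : L →ₗ[ℤ] L) = LinearMap.det (α : L →ₗ[ℤ] L) := by
  have h := IsometryEquiv.det_symm_mul_det_eq_one α
  rcases LinearMap.BilinForm.IsometryEquiv.det_eq_one_or_eq_neg_one α with h1 | h1 <;> rw [h1] at h ⊢ <;> linarith

end Closure

section Character

variable {W : Type*} [AddCommGroup W] {B : BilinForm ℤ W} {A : Type*} [CommGroup A] {f : B.IsometryEquiv B → A}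
  {G : B.IsometryEquiv B → Prop}

/-- A map to an abelian group, multiplicative on a subgroup `G ∋ 1`, sends `1 ↦ 1`.
[cite: GritsenkoHulekSankaran2009, Cor. 1.8 (characters)] -/
theorem map_refl_eq_one_of_map_trans (hG1 : G (LinearMap.BilinForm.IsometryEquiv.refl B))
    (hf : ∀ α β, G α → G β → f (α.trans β) = f α * f β) : f (LinearMap.BilinForm.IsometryEquiv.refl B) = 1 := by
  have h := hf _ _ hG1 hG1
  rw [show (LinearMap.BilinForm.IsometryEquiv.refl B).trans (LinearMap.BilinForm.IsometryEquiv.refl B) =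
      LinearMap.BilinForm.IsometryEquiv.refl B from DFunLike.ext _ _ fun v ↦ rfl] at h
  simpa using h

/-- A map to an abelian group, multiplicative on a subgroup `G`, sends inverses to inverses on `G`.
[cite: GritsenkoHulekSankaran2009, Cor. 1.8 (characters)] -/
theorem map_symm_eq_inv_of_map_trans (hG1 : G (LinearMap.BilinForm.IsometryEquiv.refl B)) (hGs : ∀ α, G α → G α.symm)
    (hf : ∀ α β, G α → G β → f (α.trans β) = f α * f β) {α : B.IsometryEquiv B} (hα : G α) : f α.symm = (f α)⁻¹ := by
  have h := hf α α.symm hα (hGs α hα)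
  rw [show α.trans α.symm = LinearMap.BilinForm.IsometryEquiv.refl B from
      DFunLike.ext _ _ fun v ↦ LinearMap.BilinForm.IsometryEquiv.symm_apply_apply α v,
    map_refl_eq_one_of_map_trans hG1 hf] at h
  exact eq_inv_of_mul_eq_one_right h.symm

/-- A map to an abelian group, multiplicative on a subgroup `G`, kills the commutators `[α,β]`, `α, β ∈ G`.
[cite: GritsenkoHulekSankaran2009, Cor. 1.8 (characters)] -/
theorem map_commutator_eq_one_of_map_trans (hG1 : G (LinearMap.BilinForm.IsometryEquiv.refl B))
    (hGt : ∀ α β, G α → G β → G (α.trans β)) (hGs : ∀ α, G α → G α.symm)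
    (hf : ∀ α β, G α → G β → f (α.trans β) = f α * f β) {α β : B.IsometryEquiv B} (hα : G α) (hβ : G β) :
    f (((β.symm.trans α.symm).trans β).trans α) = 1 := by
  have hα' := hGs α hα
  have hβ' := hGs β hβ
  rw [hf _ _ (hGt _ _ (hGt _ _ hβ' hα') hβ) hα, hf _ _ (hGt _ _ hβ' hα') hβ, hf _ _ hβ' hα',
    map_symm_eq_inv_of_map_trans hG1 hGs hf hα, map_symm_eq_inv_of_map_trans hG1 hGs hf hβ, mul_comm (f β)⁻¹,
    mul_assoc, mul_assoc, inv_mul_cancel_left, inv_mul_cancel]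

/-- **Characters kill commutator words**: a map to an abelian group, multiplicative on a subgroup `G` (closed under `1`,
products, inverses), is `1` on every word in commutators `[α,β]` of elements of `G` (and such words lie in `G`).
[cite: GritsenkoHulekSankaran2009, Cor. 1.8 (characters of S̃O⁺(L), Õ⁺(L))] -/
theorem IsWordIn.map_eq_one_of_commutators_of_map_trans (hG1 : G (LinearMap.BilinForm.IsometryEquiv.refl B))
    (hGt : ∀ α β, G α → G β → G (α.trans β)) (hGs : ∀ α, G α → G α.symm)
    (hf : ∀ α β, G α → G β → f (α.trans β) = f α * f β) {S : Set (B.IsometryEquiv B)}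
    (hS : ∀ s ∈ S, ∃ α β : B.IsometryEquiv B, G α ∧ G β ∧ s = ((β.symm.trans α.symm).trans β).trans α)
    {φ : B.IsometryEquiv B} (hφ : IsWordIn S φ) : G φ ∧ f φ = 1 := by
  refine hφ.induction_on (P := fun χ ↦ G χ ∧ f χ = 1) (fun s hs ↦ ?_) ⟨hG1, map_refl_eq_one_of_map_trans hG1 hf⟩
    (fun ψ χ hψ hχ ↦ ⟨hGt _ _ hψ.1 hχ.1, by rw [hf _ _ hψ.1 hχ.1, hψ.2, hχ.2, one_mul]⟩)
    (fun ψ hψ ↦ ⟨hGs _ hψ.1, by rw [map_symm_eq_inv_of_map_trans hG1 hGs hf hψ.1, hψ.2, inv_one]⟩)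
  obtain ⟨α, β, hα, hβ, rfl⟩ := hS s hs
  have hα' := hGs α hα
  have hβ' := hGs β hβ
  exact ⟨hGt _ _ (hGt _ _ (hGt _ _ hβ' hα') hβ) hα, map_commutator_eq_one_of_map_trans hG1 hGt hGs hf hα hβ⟩

end Character

/-! ### §1 Theorem 1.7 (i): `SO⁺(U^{⊕n})` is perfect, `n ≥ 3` -/

section Perfect

/-- Three pairwise distinct indices `i, j, k` in `Fin n`, `n ≥ 3`, the first prescribed (three hyperbolic planes of `U^{⊕n}`).
[cite: GritsenkoHulekSankaran2009, §4.1 ("L = U ⊕ U₁ ⊕ U₂ ⊕ L₀")] -/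
theorem exists_ne_ne_of_three_le {n : ℕ} (hn : 3 ≤ n) (i : Fin n) : ∃ j k : Fin n, i ≠ j ∧ i ≠ k ∧ j ≠ k := by
  by_cases h0 : i = ⟨0, by omega⟩
  · subst h0
    exact ⟨⟨1, by omega⟩, ⟨2, by omega⟩, by simp [Fin.ext_iff], by simp [Fin.ext_iff], by simp [Fin.ext_iff]⟩
  by_cases h1 : i = ⟨1, by omega⟩
  · subst h1
    exact ⟨⟨0, by omega⟩, ⟨2, by omega⟩, by simp [Fin.ext_iff], by simp [Fin.ext_iff], by simp [Fin.ext_iff]⟩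
  · exact ⟨⟨0, by omega⟩, ⟨1, by omega⟩, h0, h1, by simp [Fin.ext_iff]⟩

/-- **Theorem 1.7 (i) for `U^{⊕n}`, `n ≥ 3`: `SO⁺(U^{⊕n})^{ab}` is trivial** — every isometry of `hyperbolicSum n` in `O⁺` with
determinant `1` is a word in the commutators `[α,β] = αβα⁻¹β⁻¹` of admissible words at the plane `U_i` (stated for any set `C`
containing these commutators): `SO⁺(U^{⊕n}) = E_{U_i}` (row g50-#1, GHS (15)) and `E_{U_i}` is perfect since `U^{⊕n}` is even
with the three hyperbolic planes `U_i, U_j, U_k` (row g49-#6, §4.1). [cite: GritsenkoHulekSankaran2009, Thm. 1.7, Prop. 1.6 and §4.1] -/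
theorem hyperbolicSum_isWordIn_commutators_uGens_of_isOrientationPreserving_of_det_eq_one {n : ℕ} (hn : 3 ≤ n)
    (i : Fin n) {C : Set ((hyperbolicSum n).IsometryEquiv (hyperbolicSum n))}
    (hC : ∀ (l₁ l₂ : List (UGen ((Fin n → ℤ) × (Fin n → ℤ))))
      (hl₁ : ∀ g ∈ l₁, g.IsAdmissible (hyperbolicSum n) (Pi.single i 1, 0) (0, Pi.single i 1))
      (hl₂ : ∀ g ∈ l₂, g.IsAdmissible (hyperbolicSum n) (Pi.single i 1, 0) (0, Pi.single i 1)),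
      (((UGen.evalEquiv (isSymm_hyperbolicSum n) (hyperbolicSum_inl_inl n (Pi.single i 1) (Pi.single i 1))
              (hyperbolicSum_inr_inr n (Pi.single i 1) (Pi.single i 1)) l₂ hl₂).symm.trans
          (UGen.evalEquiv (isSymm_hyperbolicSum n) (hyperbolicSum_inl_inl n (Pi.single i 1) (Pi.single i 1))
              (hyperbolicSum_inr_inr n (Pi.single i 1) (Pi.single i 1)) l₁ hl₁).symm).trans
          (UGen.evalEquiv (isSymm_hyperbolicSum n) (hyperbolicSum_inl_inl n (Pi.single i 1) (Pi.single i 1))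
              (hyperbolicSum_inr_inr n (Pi.single i 1) (Pi.single i 1)) l₂ hl₂)).trans
        (UGen.evalEquiv (isSymm_hyperbolicSum n) (hyperbolicSum_inl_inl n (Pi.single i 1) (Pi.single i 1))
              (hyperbolicSum_inr_inr n (Pi.single i 1) (Pi.single i 1)) l₁ hl₁) ∈ C)
    (φ : (hyperbolicSum n).IsometryEquiv (hyperbolicSum n)) (h₁ : φ.IsOrientationPreserving)
    (h₂ : LinearMap.det (φ : (Fin n → ℤ) × (Fin n → ℤ) →ₗ[ℤ] (Fin n → ℤ) × (Fin n → ℤ)) = 1) : IsWordIn C φ := by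
  obtain ⟨j, k, hij, hik, hjk⟩ := exists_ne_ne_of_three_le hn i
  obtain ⟨L, hL, rfl⟩ := (hyperbolicSum_isOrientationPreserving_and_det_eq_one_iff_exists_uGens hn i φ).1 ⟨h₁, h₂⟩
  exact isWordIn_commutators_evalEquiv (twoHyperbolicPairs_hyperbolicSum hij) (twoHyperbolicPairs_hyperbolicSum hik)
    (twoHyperbolicPairs_hyperbolicSum hjk) (isEven_hyperbolicSum n) hC L hL

/-- **`[SO⁺(U^{⊕n}), SO⁺(U^{⊕n})] = SO⁺(U^{⊕n})`, `n ≥ 3` (`SO⁺` is perfect)**: an isometry of `hyperbolicSum n` is a word in the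
commutators `[α,β]`, `α, β ∈ SO⁺`, iff it lies in `SO⁺`. [cite: GritsenkoHulekSankaran2009, Thm. 1.7 and Cor. 1.8] -/
theorem hyperbolicSum_isWordIn_commutators_of_specialOrthogonal_iff {n : ℕ} (hn : 3 ≤ n)
    (φ : (hyperbolicSum n).IsometryEquiv (hyperbolicSum n)) :
    IsWordIn {ψ | ∃ α β : (hyperbolicSum n).IsometryEquiv (hyperbolicSum n),
        (α.IsOrientationPreserving ∧ LinearMap.det (α : (Fin n → ℤ) × (Fin n → ℤ) →ₗ[ℤ] (Fin n → ℤ) × (Fin n → ℤ)) = 1) ∧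
        (β.IsOrientationPreserving ∧ LinearMap.det (β : (Fin n → ℤ) × (Fin n → ℤ) →ₗ[ℤ] (Fin n → ℤ) × (Fin n → ℤ)) = 1) ∧
        ψ = ((β.symm.trans α.symm).trans β).trans α} φ ↔
      φ.IsOrientationPreserving ∧ LinearMap.det (φ : (Fin n → ℤ) × (Fin n → ℤ) →ₗ[ℤ] (Fin n → ℤ) × (Fin n → ℤ)) = 1 := by
  have hB := isSymm_hyperbolicSum n
  have hnd := (isUnimodular_hyperbolicSum n).nondegenerate
  refine ⟨fun hφ ↦ IsWordIn.isOrientationPreserving_and_det_eq_one_of_commutators hB hnd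
    (fun s hs ↦ by obtain ⟨α, β, -, -, hs⟩ := hs; exact ⟨α, β, hs⟩) hφ, fun h ↦ ?_⟩
  refine hyperbolicSum_isWordIn_commutators_uGens_of_isOrientationPreserving_of_det_eq_one hn ⟨0, by omega⟩
    (fun l₁ l₂ hl₁ hl₂ ↦ ?_) φ h.1 h.2
  exact ⟨_, _, (UGen.evalEquiv_mem_stableSpecialOrthogonal hB hnd _ _ l₁ hl₁).2,
    (UGen.evalEquiv_mem_stableSpecialOrthogonal hB hnd _ _ l₂ hl₂).2, rfl⟩

/-- **`[O⁺(U^{⊕n}), O⁺(U^{⊕n})] = SO⁺(U^{⊕n})`, `n ≥ 3`**: an isometry of `hyperbolicSum n` is a word in the commutators `[α,β]`,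
`α, β ∈ O⁺`, iff it lies in `SO⁺` (so `O⁺(U^{⊕n})^{ab} = O⁺/SO⁺`). [cite: GritsenkoHulekSankaran2009, Thm. 1.7 and Cor. 1.8] -/
theorem hyperbolicSum_isWordIn_commutators_of_isOrientationPreserving_iff {n : ℕ} (hn : 3 ≤ n)
    (φ : (hyperbolicSum n).IsometryEquiv (hyperbolicSum n)) :
    IsWordIn {ψ | ∃ α β : (hyperbolicSum n).IsometryEquiv (hyperbolicSum n),
        α.IsOrientationPreserving ∧ β.IsOrientationPreserving ∧ ψ = ((β.symm.trans α.symm).trans β).trans α} φ ↔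
      φ.IsOrientationPreserving ∧ LinearMap.det (φ : (Fin n → ℤ) × (Fin n → ℤ) →ₗ[ℤ] (Fin n → ℤ) × (Fin n → ℤ)) = 1 := by
  have hB := isSymm_hyperbolicSum n
  have hnd := (isUnimodular_hyperbolicSum n).nondegenerate
  refine ⟨fun hφ ↦ IsWordIn.isOrientationPreserving_and_det_eq_one_of_commutators hB hnd
    (fun s hs ↦ by obtain ⟨α, β, -, -, hs⟩ := hs; exact ⟨α, β, hs⟩) hφ, fun h ↦ ?_⟩
  refine hyperbolicSum_isWordIn_commutators_uGens_of_isOrientationPreserving_of_det_eq_one hn ⟨0, by omega⟩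
    (fun l₁ l₂ hl₁ hl₂ ↦ ?_) φ h.1 h.2
  exact ⟨_, _, (UGen.evalEquiv_mem_stableSpecialOrthogonal hB hnd _ _ l₁ hl₁).2.1,
    (UGen.evalEquiv_mem_stableSpecialOrthogonal hB hnd _ _ l₂ hl₂).2.1, rfl⟩

end Perfect

/-! ### §2 The cosets of `SO⁺(U^{⊕n})` in `O(U^{⊕n})`: `O⁺^{ab} ≅ ℤ/2ℤ`, `O^{ab} ≅ (ℤ/2ℤ)²` -/

section Cosets

/-- **Same coset of `[O, O] = SO⁺(U^{⊕n})` iff same `(χ, det)`**, `n ≥ 3`: `φρ⁻¹` is a word in commutators iff `φ`, `ρ` are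
both or neither in `O⁺` and `det φ = det ρ` — the injection `O(U^{⊕n})^{ab} ↪ {±1}²`, `φ ↦ (sn_ℝ(φ), det φ)`.
[cite: GritsenkoHulekSankaran2009, Cor. 1.8 and p. 4 ("O(L_{2d})^{ab} ≅ (ℤ/2ℤ)^{ρ(d)+2}")] -/
theorem hyperbolicSum_isWordIn_commutators_trans_symm_iff {n : ℕ} (hn : 3 ≤ n)
    (φ ρ : (hyperbolicSum n).IsometryEquiv (hyperbolicSum n)) :
    IsWordIn {ψ | ∃ α β : (hyperbolicSum n).IsometryEquiv (hyperbolicSum n), ψ = ((β.symm.trans α.symm).trans β).trans α}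
        (φ.trans ρ.symm) ↔
      (φ.IsOrientationPreserving ↔ ρ.IsOrientationPreserving) ∧
        LinearMap.det (φ : (Fin n → ℤ) × (Fin n → ℤ) →ₗ[ℤ] (Fin n → ℤ) × (Fin n → ℤ)) =
          LinearMap.det (ρ : (Fin n → ℤ) × (Fin n → ℤ) →ₗ[ℤ] (Fin n → ℤ) × (Fin n → ℤ)) := by
  have hB := isSymm_hyperbolicSum n
  have hnd := (isUnimodular_hyperbolicSum n).nondegenerate
  rw [hyperbolicSum_isWordIn_commutators_iff hn, LinearMap.BilinForm.IsometryEquiv.isOrientationPreserving_trans_iff hB hnd,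
    LinearMap.BilinForm.IsometryEquiv.isOrientationPreserving_symm_iff hB hnd, IsometryEquiv.det_trans_eq_mul,
    IsometryEquiv.det_symm_eq]
  rcases LinearMap.BilinForm.IsometryEquiv.det_eq_one_or_eq_neg_one ρ with hρ | hρ <;>
    rcases LinearMap.BilinForm.IsometryEquiv.det_eq_one_or_eq_neg_one φ with hφ | hφ <;>
    simp [hρ, hφ, iff_comm]

/-- `e_j + f_j` is a `(+2)`-vector of `U^{⊕n}`. [cite: GritsenkoHulekSankaran2009, §1 ("if L contains at least one 2-vector")] -/
theorem hyperbolicSum_single_single (n : ℕ) (j : Fin n) :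
    hyperbolicSum n ((Pi.single j 1, Pi.single j 1) : (Fin n → ℤ) × (Fin n → ℤ)) (Pi.single j 1, Pi.single j 1) = 1 + 1 := by
  rw [hyperbolicSum_apply]
  simp

/-- **The four coset representatives** `1`, `σ₋ = σ_{e_j−f_j}`, `σ₊ = σ_{e_j+f_j}`, `σ₋σ₊` of `SO⁺(U^{⊕n})` in `O(U^{⊕n})` and their
invariants `(χ, det) = (+,+), (+,−), (−,−), (−,+)`: `σ₋ ∈ O⁺`, `σ₊ ∉ O⁺`, `det σ± = −1`, `σ₋σ₊ ∉ O⁺` with `det = 1`.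
[cite: GritsenkoHulekSankaran2009, §1 ("σ_a … belongs to Õ⁺(L)" for a² = −2) and §4 ("Õ⁺(L) = ⟨S̃O⁺(L), σ_{e−f}⟩")] -/
theorem hyperbolicSum_reflections_invariants {n : ℕ} (j : Fin n) :
    (normTwoReflectionEquiv (isSymm_hyperbolicSum n) (Pi.single j 1, -Pi.single j 1) (-1) (hyperbolicSum_single_neg_single n j)
        (by norm_num)).IsOrientationPreserving ∧
    LinearMap.det ((normTwoReflectionEquiv (isSymm_hyperbolicSum n) (Pi.single j 1, -Pi.single j 1) (-1)
        (hyperbolicSum_single_neg_single n j) (by norm_num) : (hyperbolicSum n).IsometryEquiv (hyperbolicSum n)) :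
        (Fin n → ℤ) × (Fin n → ℤ) →ₗ[ℤ] (Fin n → ℤ) × (Fin n → ℤ)) = -1 ∧
    ¬ (normTwoReflectionEquiv (isSymm_hyperbolicSum n) (Pi.single j 1, Pi.single j 1) 1 (hyperbolicSum_single_single n j)
        (by norm_num)).IsOrientationPreserving ∧
    LinearMap.det ((normTwoReflectionEquiv (isSymm_hyperbolicSum n) (Pi.single j 1, Pi.single j 1) 1
        (hyperbolicSum_single_single n j) (by norm_num) : (hyperbolicSum n).IsometryEquiv (hyperbolicSum n)) :
        (Fin n → ℤ) × (Fin n → ℤ) →ₗ[ℤ] (Fin n → ℤ) × (Fin n → ℤ)) = -1 ∧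
    ¬ ((normTwoReflectionEquiv (isSymm_hyperbolicSum n) (Pi.single j 1, -Pi.single j 1) (-1)
          (hyperbolicSum_single_neg_single n j) (by norm_num)).trans
        (normTwoReflectionEquiv (isSymm_hyperbolicSum n) (Pi.single j 1, Pi.single j 1) 1 (hyperbolicSum_single_single n j)
          (by norm_num))).IsOrientationPreserving ∧
    LinearMap.det (((normTwoReflectionEquiv (isSymm_hyperbolicSum n) (Pi.single j 1, -Pi.single j 1) (-1)
          (hyperbolicSum_single_neg_single n j) (by norm_num)).trans
        (normTwoReflectionEquiv (isSymm_hyperbolicSum n) (Pi.single j 1, Pi.single j 1) 1 (hyperbolicSum_single_single n j)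
          (by norm_num)) : (hyperbolicSum n).IsometryEquiv (hyperbolicSum n)) :
        (Fin n → ℤ) × (Fin n → ℤ) →ₗ[ℤ] (Fin n → ℤ) × (Fin n → ℤ)) = 1 := by
  have hB := isSymm_hyperbolicSum n
  have hnd := (isUnimodular_hyperbolicSum n).nondegenerate
  have hm : (normTwoReflectionEquiv hB (Pi.single j 1, -Pi.single j 1) (-1) (hyperbolicSum_single_neg_single n j)
      (by norm_num)).IsOrientationPreserving := by
    rw [isOrientationPreserving_normTwoReflectionEquiv_iff _ hB hnd]
  have hp : ¬ (normTwoReflectionEquiv hB (Pi.single j 1, Pi.single j 1) 1 (hyperbolicSum_single_single n j)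
      (by norm_num)).IsOrientationPreserving := by
    rw [isOrientationPreserving_normTwoReflectionEquiv_iff _ hB hnd]
    norm_num
  refine ⟨hm, det_normTwoReflectionEquiv _ hB _ _ _ _, hp, det_normTwoReflectionEquiv _ hB _ _ _ _, ?_, ?_⟩
  · rw [LinearMap.BilinForm.IsometryEquiv.isOrientationPreserving_trans_iff hB hnd]
    exact fun h ↦ hp (h.2 hm)
  · rw [IsometryEquiv.det_trans_eq_mul, det_normTwoReflectionEquiv _ hB, det_normTwoReflectionEquiv _ hB]
    norm_num

/-- **Theorem 1.7 (ii) for `U^{⊕n}`, `n ≥ 3`: `O⁺(U^{⊕n})^{ab} ≅ ℤ/2ℤ`** — `O⁺ = SO⁺ ⊔ SO⁺·σ₋` with `SO⁺ = [O⁺, O⁺]` (§1): for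
`φ ∈ O⁺` exactly one of `φ`, `φσ₋⁻¹` is a word in commutators (`σ₋ = σ_{e_j−f_j}`; "`Õ⁺(L) = ⟨S̃O⁺(L), σ_{e−f}⟩`").
[cite: GritsenkoHulekSankaran2009, Thm. 1.7, Prop. 1.6 and §4] -/
theorem hyperbolicSum_xor_isWordIn_commutators_of_isOrientationPreserving {n : ℕ} (hn : 3 ≤ n) (j : Fin n)
    (φ : (hyperbolicSum n).IsometryEquiv (hyperbolicSum n)) (h₁ : φ.IsOrientationPreserving) :
    Xor (IsWordIn {ψ | ∃ α β : (hyperbolicSum n).IsometryEquiv (hyperbolicSum n),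
        ψ = ((β.symm.trans α.symm).trans β).trans α} φ)
      (IsWordIn {ψ | ∃ α β : (hyperbolicSum n).IsometryEquiv (hyperbolicSum n),
        ψ = ((β.symm.trans α.symm).trans β).trans α}
        (φ.trans (normTwoReflectionEquiv (isSymm_hyperbolicSum n) (Pi.single j 1, -Pi.single j 1) (-1)
          (hyperbolicSum_single_neg_single n j) (by norm_num)).symm)) := by
  obtain ⟨hO, hd, -⟩ := hyperbolicSum_reflections_invariants (n := n) j
  rw [hyperbolicSum_isWordIn_commutators_iff hn, hyperbolicSum_isWordIn_commutators_trans_symm_iff hn, hd]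
  rcases LinearMap.BilinForm.IsometryEquiv.det_eq_one_or_eq_neg_one φ with h | h
  · exact Or.inl ⟨⟨h₁, h⟩, fun h' ↦ by rw [h] at h'; norm_num at h'⟩
  · exact Or.inr ⟨⟨iff_of_true h₁ hO, h⟩, fun h' ↦ by rw [h] at h'; norm_num at h'⟩

/-- **`O(U^{⊕n})^{ab} ≅ (ℤ/2ℤ)²`, `n ≥ 3`: the four cosets of `[O, O] = SO⁺(U^{⊕n})`** — every isometry `φ` of `hyperbolicSum n`
lies in the coset of exactly one of `1`, `σ₋ = σ_{e_j−f_j}`, `σ₊ = σ_{e_j+f_j}`, `σ₋σ₊` (i.e. `φρ⁻¹ ∈ [O,O]`), according to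
`(χ(φ), det φ) ∈ {±1}²` (`hyperbolicSum_isWordIn_commutators_trans_symm_iff` makes the four cases mutually exclusive).
The `U^{⊕n}` case of "`O(L_{2d})^{ab} ≅ (ℤ/2ℤ)^{ρ(d)+2}`" (`O(q_{U^{⊕n}}) = 1`). [cite: GritsenkoHulekSankaran2009, Cor. 1.8 and p. 4] -/
theorem hyperbolicSum_isWordIn_commutators_or_or_or {n : ℕ} (hn : 3 ≤ n) (j : Fin n)
    (φ : (hyperbolicSum n).IsometryEquiv (hyperbolicSum n)) :
    IsWordIn {ψ | ∃ α β : (hyperbolicSum n).IsometryEquiv (hyperbolicSum n), ψ = ((β.symm.trans α.symm).trans β).trans α} φ ∨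
    IsWordIn {ψ | ∃ α β : (hyperbolicSum n).IsometryEquiv (hyperbolicSum n), ψ = ((β.symm.trans α.symm).trans β).trans α}
      (φ.trans (normTwoReflectionEquiv (isSymm_hyperbolicSum n) (Pi.single j 1, -Pi.single j 1) (-1)
        (hyperbolicSum_single_neg_single n j) (by norm_num)).symm) ∨
    IsWordIn {ψ | ∃ α β : (hyperbolicSum n).IsometryEquiv (hyperbolicSum n), ψ = ((β.symm.trans α.symm).trans β).trans α}
      (φ.trans (normTwoReflectionEquiv (isSymm_hyperbolicSum n) (Pi.single j 1, Pi.single j 1) 1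
        (hyperbolicSum_single_single n j) (by norm_num)).symm) ∨
    IsWordIn {ψ | ∃ α β : (hyperbolicSum n).IsometryEquiv (hyperbolicSum n), ψ = ((β.symm.trans α.symm).trans β).trans α}
      (φ.trans ((normTwoReflectionEquiv (isSymm_hyperbolicSum n) (Pi.single j 1, -Pi.single j 1) (-1)
          (hyperbolicSum_single_neg_single n j) (by norm_num)).trans
        (normTwoReflectionEquiv (isSymm_hyperbolicSum n) (Pi.single j 1, Pi.single j 1) 1 (hyperbolicSum_single_single n j)
          (by norm_num))).symm) := by
  obtain ⟨hOm, hdm, hOp, hdp, hO, hd⟩ := hyperbolicSum_reflections_invariants (n := n) j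
  rw [hyperbolicSum_isWordIn_commutators_iff hn, hyperbolicSum_isWordIn_commutators_trans_symm_iff hn,
    hyperbolicSum_isWordIn_commutators_trans_symm_iff hn, hyperbolicSum_isWordIn_commutators_trans_symm_iff hn, hdm, hdp, hd]
  by_cases h₁ : φ.IsOrientationPreserving <;>
    rcases LinearMap.BilinForm.IsometryEquiv.det_eq_one_or_eq_neg_one φ with h | h
  · exact Or.inl ⟨h₁, h⟩
  · exact Or.inr (Or.inl ⟨iff_of_true h₁ hOm, h⟩)
  · exact Or.inr (Or.inr (Or.inr ⟨iff_of_false h₁ hO, h⟩))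
  · exact Or.inr (Or.inr (Or.inl ⟨iff_of_false h₁ hOp, h⟩))

end Cosets

/-! ### §3 Corollary 1.8: the characters of `SO⁺(U^{⊕n})`, `O⁺(U^{⊕n})`, `O(U^{⊕n})`, `n ≥ 3` -/

section Characters

variable {n : ℕ} {A : Type*} [CommGroup A] {f : (hyperbolicSum n).IsometryEquiv (hyperbolicSum n) → A}

/-- **Cor. 1.8 for `U^{⊕n}`, `n ≥ 3`: `SO⁺(U^{⊕n})` has no non-trivial characters** — a map to an abelian group which is
multiplicative on `SO⁺` is `1` on `SO⁺` (`SO⁺` is perfect, §1). [cite: GritsenkoHulekSankaran2009, Cor. 1.8 and Thm. 1.7] -/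
theorem hyperbolicSum_character_eq_one_of_specialOrthogonal (hn : 3 ≤ n)
    (hf : ∀ α β : (hyperbolicSum n).IsometryEquiv (hyperbolicSum n),
      (α.IsOrientationPreserving ∧ LinearMap.det (α : (Fin n → ℤ) × (Fin n → ℤ) →ₗ[ℤ] (Fin n → ℤ) × (Fin n → ℤ)) = 1) →
      (β.IsOrientationPreserving ∧ LinearMap.det (β : (Fin n → ℤ) × (Fin n → ℤ) →ₗ[ℤ] (Fin n → ℤ) × (Fin n → ℤ)) = 1) →
      f (α.trans β) = f α * f β)
    (φ : (hyperbolicSum n).IsometryEquiv (hyperbolicSum n)) (hφ : φ.IsOrientationPreserving ∧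
      LinearMap.det (φ : (Fin n → ℤ) × (Fin n → ℤ) →ₗ[ℤ] (Fin n → ℤ) × (Fin n → ℤ)) = 1) : f φ = 1 :=
  (IsWordIn.map_eq_one_of_commutators_of_map_trans
    (G := fun α : (hyperbolicSum n).IsometryEquiv (hyperbolicSum n) ↦ α.IsOrientationPreserving ∧
      LinearMap.det (α : (Fin n → ℤ) × (Fin n → ℤ) →ₗ[ℤ] (Fin n → ℤ) × (Fin n → ℤ)) = 1)
    specialOrthogonal_refl
    (specialOrthogonal_trans (isSymm_hyperbolicSum n) (isUnimodular_hyperbolicSum n).nondegenerate)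
    (specialOrthogonal_symm (isSymm_hyperbolicSum n) (isUnimodular_hyperbolicSum n).nondegenerate) hf (fun _ hs ↦ hs)
    ((hyperbolicSum_isWordIn_commutators_of_specialOrthogonal_iff hn φ).2 hφ)).2

/-- **Cor. 1.8 for `U^{⊕n}`, `n ≥ 3`: every character of `O⁺(U^{⊕n})` factors through `det`** ("`Õ⁺(L)` has only one
non-trivial character, namely `det`") — a map to an abelian group multiplicative on `O⁺` takes the same value on `φ, ψ ∈ O⁺`
whenever `det φ = det ψ`. [cite: GritsenkoHulekSankaran2009, Cor. 1.8 and Thm. 1.7] -/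
theorem hyperbolicSum_character_eq_of_isOrientationPreserving_of_det_eq (hn : 3 ≤ n)
    (hf : ∀ α β : (hyperbolicSum n).IsometryEquiv (hyperbolicSum n), α.IsOrientationPreserving → β.IsOrientationPreserving →
      f (α.trans β) = f α * f β)
    (φ ψ : (hyperbolicSum n).IsometryEquiv (hyperbolicSum n)) (hφ : φ.IsOrientationPreserving) (hψ : ψ.IsOrientationPreserving)
    (hdet : LinearMap.det (φ : (Fin n → ℤ) × (Fin n → ℤ) →ₗ[ℤ] (Fin n → ℤ) × (Fin n → ℤ)) =
      LinearMap.det (ψ : (Fin n → ℤ) × (Fin n → ℤ) →ₗ[ℤ] (Fin n → ℤ) × (Fin n → ℤ))) : f φ = f ψ := by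
  have hB := isSymm_hyperbolicSum n
  have hnd := (isUnimodular_hyperbolicSum n).nondegenerate
  have hψ' : ψ.symm.IsOrientationPreserving := (LinearMap.BilinForm.IsometryEquiv.isOrientationPreserving_symm_iff hB hnd ψ).2 hψ
  -- `φψ⁻¹ ∈ SO⁺`, so `f (φψ⁻¹) = 1`
  have h1 : f (φ.trans ψ.symm) = 1 := by
    refine hyperbolicSum_character_eq_one_of_specialOrthogonal hn (fun α β hα hβ ↦ hf α β hα.1 hβ.1) _ ⟨?_, ?_⟩
    · exact (LinearMap.BilinForm.IsometryEquiv.isOrientationPreserving_trans_iff hB hnd φ ψ.symm).2 (iff_of_true hψ' hφ)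
    · rw [IsometryEquiv.det_trans_eq_mul, IsometryEquiv.det_symm_eq, hdet]
      rcases LinearMap.BilinForm.IsometryEquiv.det_eq_one_or_eq_neg_one ψ with h | h <;> rw [h] <;> norm_num
  rw [hf φ ψ.symm hφ hψ', map_symm_eq_inv_of_map_trans (G := fun α : (hyperbolicSum n).IsometryEquiv (hyperbolicSum n) ↦
      α.IsOrientationPreserving) LinearMap.BilinForm.IsometryEquiv.IsOrientationPreserving.refl
    (fun α hα ↦ (LinearMap.BilinForm.IsometryEquiv.isOrientationPreserving_symm_iff hB hnd α).2 hα) hf hψ] at h1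
  exact mul_inv_eq_one.1 h1

/-- **Characters of `O(U^{⊕n})` factor through `(χ, det)`, `n ≥ 3`** (`O(U^{⊕n})^{ab} ≅ (ℤ/2ℤ)²`): a multiplicative map to an
abelian group takes the same value on `φ, ψ` whenever `χ(φ) = χ(ψ)` and `det φ = det ψ`.
[cite: GritsenkoHulekSankaran2009, Cor. 1.8 and p. 4 ("O(L_{2d})^{ab} ≅ (ℤ/2ℤ)^{ρ(d)+2}")] -/
theorem hyperbolicSum_character_eq_of_det_eq (hn : 3 ≤ n)
    (hf : ∀ α β : (hyperbolicSum n).IsometryEquiv (hyperbolicSum n), f (α.trans β) = f α * f β)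
    (φ ψ : (hyperbolicSum n).IsometryEquiv (hyperbolicSum n)) (hχ : φ.IsOrientationPreserving ↔ ψ.IsOrientationPreserving)
    (hdet : LinearMap.det (φ : (Fin n → ℤ) × (Fin n → ℤ) →ₗ[ℤ] (Fin n → ℤ) × (Fin n → ℤ)) =
      LinearMap.det (ψ : (Fin n → ℤ) × (Fin n → ℤ) →ₗ[ℤ] (Fin n → ℤ) × (Fin n → ℤ))) : f φ = f ψ := by
  have h1 : f (φ.trans ψ.symm) = 1 :=
    (IsWordIn.map_eq_one_of_commutators_of_map_trans (G := fun _ : (hyperbolicSum n).IsometryEquiv (hyperbolicSum n) ↦ True)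
      trivial (fun _ _ _ _ ↦ trivial) (fun _ _ ↦ trivial) (fun α β _ _ ↦ hf α β) (fun _ hs ↦ by obtain ⟨α, β, hs⟩ := hs; exact ⟨α, β, trivial, trivial, hs⟩)
      ((hyperbolicSum_isWordIn_commutators_trans_symm_iff hn φ ψ).2 ⟨hχ, hdet⟩)).2
  rw [hf, map_symm_eq_inv_of_map_trans (G := fun _ : (hyperbolicSum n).IsometryEquiv (hyperbolicSum n) ↦ True) trivial
    (fun _ _ ↦ trivial) (fun α β _ _ ↦ hf α β) trivial] at h1
  exact mul_inv_eq_one.1 h1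

/-- **`O(U^{⊕n})^{ab}` is `2`-torsion, `n ≥ 3`**: every multiplicative map to an abelian group satisfies `f(φ)² = 1`
(`φ² ∈ SO⁺ = [O, O]`). [cite: GritsenkoHulekSankaran2009, Cor. 1.8 and p. 4 ("O(L_{2d})^{ab} ≅ (ℤ/2ℤ)^{ρ(d)+2}")] -/
theorem hyperbolicSum_character_mul_self (hn : 3 ≤ n)
    (hf : ∀ α β : (hyperbolicSum n).IsometryEquiv (hyperbolicSum n), f (α.trans β) = f α * f β)
    (φ : (hyperbolicSum n).IsometryEquiv (hyperbolicSum n)) : f φ * f φ = 1 := by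
  have hB := isSymm_hyperbolicSum n
  have hnd := (isUnimodular_hyperbolicSum n).nondegenerate
  rw [← hf]
  refine hyperbolicSum_character_eq_one_of_specialOrthogonal hn (fun α β _ _ ↦ hf α β) _ ⟨?_, ?_⟩
  · exact (LinearMap.BilinForm.IsometryEquiv.isOrientationPreserving_trans_iff hB hnd φ φ).2 Iff.rfl
  · rw [IsometryEquiv.det_trans_eq_mul]
    rcases LinearMap.BilinForm.IsometryEquiv.det_eq_one_or_eq_neg_one φ with h | h <;> rw [h] <;> norm_num

/-- **`det` is a non-trivial character of `O⁺(U^{⊕n})`** (so `O⁺(U^{⊕n})^{ab}` is exactly `ℤ/2ℤ`): it is multiplicative and takes the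
value `−1` on `σ_{e_j−f_j} ∈ O⁺`. [cite: GritsenkoHulekSankaran2009, Cor. 1.8 ("only one non-trivial character, namely det")] -/
theorem hyperbolicSum_det_character {n : ℕ} (j : Fin n) :
    (∀ α β : (hyperbolicSum n).IsometryEquiv (hyperbolicSum n),
      LinearMap.det ((α.trans β : (hyperbolicSum n).IsometryEquiv (hyperbolicSum n)) :
          (Fin n → ℤ) × (Fin n → ℤ) →ₗ[ℤ] (Fin n → ℤ) × (Fin n → ℤ)) =
        LinearMap.det (α : (Fin n → ℤ) × (Fin n → ℤ) →ₗ[ℤ] (Fin n → ℤ) × (Fin n → ℤ)) *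
          LinearMap.det (β : (Fin n → ℤ) × (Fin n → ℤ) →ₗ[ℤ] (Fin n → ℤ) × (Fin n → ℤ))) ∧
    (normTwoReflectionEquiv (isSymm_hyperbolicSum n) (Pi.single j 1, -Pi.single j 1) (-1) (hyperbolicSum_single_neg_single n j)
        (by norm_num)).IsOrientationPreserving ∧
    LinearMap.det ((normTwoReflectionEquiv (isSymm_hyperbolicSum n) (Pi.single j 1, -Pi.single j 1) (-1)
        (hyperbolicSum_single_neg_single n j) (by norm_num) : (hyperbolicSum n).IsometryEquiv (hyperbolicSum n)) :
        (Fin n → ℤ) × (Fin n → ℤ) →ₗ[ℤ] (Fin n → ℤ) × (Fin n → ℤ)) = -1 := by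
  obtain ⟨hO, hd, -⟩ := hyperbolicSum_reflections_invariants (n := n) j
  exact ⟨fun α β ↦ by rw [IsometryEquiv.det_trans_eq_mul, mul_comm], hO, hd⟩

end Characters

end Literature.Topology.FourManifolds

end
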